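/-
Copyright (c) 2026. All rights reserved.
Released under Apache 2.0 license as described in the file LICENSE.
Authors: abc-iut cell, cone prover seat abc-iut-w6-d029 (block C / W6).
-/
import Literature.AnabelianGeometry.AbsoluteAnabelian.LogShells
import Mathlib.Analysis.SpecialFunctions.Complex.Arg
import Mathlib.Analysis.SpecialFunctions.Complex.Log
import Mathlib.Algebra.Order.Archimedean.Basic

/-!
# [AbsTopIII] Definition 5.4 (v): the archimedean pre-log-shell `ℐ*` — proofs

S. Mochizuki, *Topics in absolute anabelian geometry III: global reconstruction algorithms*,
J. Math. Sci. Univ. Tokyo 22 (2015) 939–1156 [MochizukiAbsTopIII2015]; locators `p.N` = pages of the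
author's manuscript (lit key `paper:url-5493eb38cbb7`), read on the page: Def 5.4 (v) p. 127 l. 17 –
p. 128 l. 12, Def 4.1 (iv) p. 104 (last lines) – p. 105 l. 1 (the archimedean pre-log-shell
`𝒪^×_k ⊆ k^×` inside the natural quotient `k~ ↠ k^×`).

PROOF-ONLY companion (no new definitions) of `LogShells.lean` §D (statement-typer seat abc-iut-L4-t3),
proving, in that file's model `k~ ≅ ℂ` (`k~ ↠ k^×` = `Complex.exp`, `ℐ* = ComplexLogShell.preLogShell
= {t·i : t ∈ [-π, π]}`, `𝒪^×_{k~} = ComplexLogShell.units` = the unit circle, `ℐ = ComplexLogShell.logShell`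
= the closed disc of radius `π`), the Prop-valued clauses PRINTED in Def 5.4 (v) that were not yet theorems:

* p. 128 l. 2–5: `ℐ*` is "the uniquely determined line segment [closure of a connected pre-compact open subset
  of a one-parameter subgroup] of `k~` which is preserved by multiplication by `±1` and whose endpoints differ
  by a generator of `Ker(k~ ↠ k^×)`" — `ComplexLogShell.eq_preLogShell_of_neg_mem_of_endpoints`
  (uniqueness among the segments `{t·w : t ∈ [a, b]}`), with `ComplexLogShell.neg_mem_preLogShell`,
  `ComplexLogShell.preLogShell_endpoints_sub`, `ComplexLogShell.exp_eq_one_iff_exists_int_mul_endpoints_sub`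
  (`ℐ*` itself has these properties: `πi - (-πi) = 2πi` generates `Ker(exp) = 2πiℤ`);
* p. 127 last display: `ℐ := 𝒪^×_{k~} · ℐ*` — `ComplexLogShell.units_mul_preLogShell` (the typed `logShell`
  IS this pointwise product), and the full display `𝒪_{k~} = π⁻¹·ℐ ⊆ ℐ = 𝒪^×_{k~}·ℐ* ⊆ k~` —
  `ComplexLogShell.def54v_display` (assembling L4-t3's `closedBall_one_eq_smul_logShell`,
  `closedBall_one_subset_logShell`);
* p. 128 l. 5–6: "`ℐ*` maps bijectively, except for the endpoints of the line segment, to the pre-log-shell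
  [`𝒪^×_k ⊆ k^×`]" — `ComplexLogShell.exp_image_preLogShell` (`exp(ℐ*) =` unit circle),
  `ComplexLogShell.bijOn_exp_preLogShell_diff_endpoint` (a bijection once one endpoint is removed),
  `ComplexLogShell.exp_endpoints_eq` (the two endpoints have the same image `-1`);
* p. 128 l. 9–12: "`ℐ` may be constructed as the closure of the union of the images of `ℐ*` via the finite
  order automorphisms of the Aut-holomorphic group `k~`" — in the model the holomorphic additive automorphisms
  of `k~ ≅ ℂ` are `z ↦ c·z` (`c ≠ 0`), the finite-order ones being `c = ζ` a root of unity —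
  `ComplexLogShell.closure_iUnion_rootOfUnity_smul_preLogShell`.

Cone node `AbsTopIII:Def5.4(v)` of the cell's DAG (statement files p404505 `LogFrobeniusGraphs.lean`,
p403899 `LogShells.lean`). Refereed pre-IUT anabelian geometry (elementary complex analysis in the model);
nothing here bears on the disputed [IUTchIII] Cor. 3.12; typed ≠ discharged.
-/

set_option autoImplicit false

noncomputable section

open Set Metric Complex
open scoped Pointwise Real

namespace Literature.AnabelianGeometry.AbsoluteAnabelian

namespace ComplexLogShell

/-! ## `ℐ*` has the printed properties -/

/-- `ℐ*` is the segment `{t·i : t ∈ [-π, π]}` of the one-parameter subgroup `ℝ·i` of `k~ ≅ ℂ`.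
[cite: MochizukiAbsTopIII2015, Def 5.4 (v) p. 128] -/
theorem preLogShell_eq_image : preLogShell = (fun t : ℝ => (t : ℂ) * I) '' Icc (-π) π := rfl

/-- `ℐ*` "is preserved by multiplication by `±1`". [cite: MochizukiAbsTopIII2015, Def 5.4 (v) p. 128] -/
theorem neg_mem_preLogShell {z : ℂ} (hz : z ∈ preLogShell) : -z ∈ preLogShell := by
  obtain ⟨t, ⟨ht1, ht2⟩, rfl⟩ := hz
  exact ⟨-t, ⟨by linarith, by linarith⟩, by push_cast; ring⟩

/-- `ℐ*` is preserved by multiplication by `ε = ±1` (set form). [cite: MochizukiAbsTopIII2015, Def 5.4 (v) p. 128] -/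
theorem smul_preLogShell_of_eq_or_eq_neg {ε : ℂ} (hε : ε = 1 ∨ ε = -1) : ε • preLogShell = preLogShell := by
  rcases hε with rfl | rfl
  · exact one_smul _ _
  · ext z
    simp only [Set.mem_smul_set, smul_eq_mul, neg_mul, one_mul]
    constructor
    · rintro ⟨y, hy, rfl⟩
      exact neg_mem_preLogShell hy
    · intro hz
      exact ⟨-z, neg_mem_preLogShell hz, neg_neg z⟩

/-- the endpoints `πi`, `-πi` of `ℐ*` "differ by" `2πi`. [cite: MochizukiAbsTopIII2015, Def 5.4 (v) p. 128] -/
theorem preLogShell_endpoints_sub : (π : ℂ) * I - (-π : ℝ) * I = 2 * π * I := by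
  push_cast; ring

/-- … and `2πi` is "a generator of `Ker(k~ ↠ k^×)`": `exp z = 1 ↔ z ∈ ℤ · (πi - (-πi))`.
[cite: MochizukiAbsTopIII2015, Def 5.4 (v) p. 128] -/
theorem exp_eq_one_iff_exists_int_mul_endpoints_sub (z : ℂ) :
    exp z = 1 ↔ ∃ n : ℤ, z = n * ((π : ℂ) * I - (-π : ℝ) * I) := by
  rw [preLogShell_endpoints_sub]
  exact Complex.exp_eq_one_iff

/-! ## Uniqueness of `ℐ*` -/

/-- the symmetric segment `{t·w : t ∈ [-b, b]}` with `b·w = ε·πi`, `ε = ±1`, `0 < b`, is `ℐ*`.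
[cite: MochizukiAbsTopIII2015, Def 5.4 (v) p. 128] -/
theorem image_Icc_eq_preLogShell_of_mul_eq {b : ℝ} (hb : 0 < b) {w : ℂ} {ε : ℝ} (hε : ε = 1 ∨ ε = -1)
    (hw : (b : ℂ) * w = ε * π * I) : (fun t : ℝ => (t : ℂ) * w) '' Icc (-b) b = preLogShell := by
  have hb0 : (b : ℂ) ≠ 0 := by exact_mod_cast hb.ne'
  have hw' : w = (ε * π / b : ℝ) * I := by
    have : w = (b : ℂ)⁻¹ * ((b : ℂ) * w) := by rw [← mul_assoc, inv_mul_cancel₀ hb0, one_mul]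
    rw [this, hw]; push_cast; field_simp
  have hε2 : ε * ε = 1 := by rcases hε with rfl | rfl <;> norm_num
  have hεabs : |ε| = 1 := by rcases hε with rfl | rfl <;> norm_num
  ext z
  simp only [preLogShell, coreSegment, mem_image, mem_Icc]
  constructor
  · rintro ⟨t, ht, rfl⟩
    refine ⟨t * (ε * π / b), ?_, by rw [hw']; push_cast; ring⟩
    have habs : |t * (ε * π / b)| = |t| * π / b := by
      rw [abs_mul, abs_div, abs_mul, hεabs, one_mul, abs_of_pos Real.pi_pos, abs_of_pos hb]; ring
    have ht' : |t| ≤ b := abs_le.2 ht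
    have : |t| * π / b ≤ π := by
      rw [div_le_iff₀ hb]; nlinarith [Real.pi_pos]
    exact abs_le.1 (habs ▸ this)
  · rintro ⟨u, hu, rfl⟩
    have key : (u * b * ε / π) * (ε * π / b) = u := by
      have : (u * b * ε / π) * (ε * π / b) = u * (ε * ε) * (b / b) * (π / π) := by ring
      rw [this, hε2, div_self hb.ne', div_self Real.pi_pos.ne']; ring
    refine ⟨u * b * ε / π, ?_, by rw [hw', ← mul_assoc, ← ofReal_mul, key]⟩
    have habs : |u * b * ε / π| = |u| * b / π := by
      rw [abs_div, abs_mul, abs_mul, hεabs, mul_one, abs_of_pos Real.pi_pos, abs_of_pos hb]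
    have hu' : |u| ≤ π := abs_le.2 hu
    have : |u| * b / π ≤ b := by
      rw [div_le_iff₀ Real.pi_pos]; nlinarith [Real.pi_pos]
    exact abs_le.1 (habs ▸ this)

/-- **Def 5.4 (v), uniqueness of `ℐ*`**: a line segment `S = {t·w : t ∈ [a, b]}` of a one-parameter subgroup
`ℝ·w` of `k~ ≅ ℂ` which is preserved by multiplication by `-1` and whose endpoints `a·w`, `b·w` differ by a
generator `±2πi` of `Ker(exp : k~ ↠ k^×)` IS `ℐ*`. [cite: MochizukiAbsTopIII2015, Def 5.4 (v) p. 128] -/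
theorem eq_preLogShell_of_neg_mem_of_endpoints {w : ℂ} {a b : ℝ} (hab : a ≤ b) {S : Set ℂ}
    (hS : S = (fun t : ℝ => (t : ℂ) * w) '' Icc a b) (hneg : ∀ z ∈ S, -z ∈ S)
    (hends : (b : ℂ) * w - (a : ℂ) * w = 2 * π * I ∨ (b : ℂ) * w - (a : ℂ) * w = -(2 * π * I)) :
    S = preLogShell := by
  -- the difference of the endpoints is `ε · 2πi`
  obtain ⟨ε, hε, hd⟩ : ∃ ε : ℝ, (ε = 1 ∨ ε = -1) ∧ (b : ℂ) * w - (a : ℂ) * w = ε * (2 * π * I) := by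
    rcases hends with h | h
    · exact ⟨1, Or.inl rfl, by rw [h]; push_cast; ring⟩
    · exact ⟨-1, Or.inr rfl, by rw [h]; push_cast; ring⟩
  have hε0 : (ε : ℂ) ≠ 0 := by rcases hε with rfl | rfl <;> norm_num
  have h2pi : (2 * π * I : ℂ) ≠ 0 := by simp [Real.pi_pos.ne']
  -- hence `w ≠ 0` and `a < b`
  have hw0 : w ≠ 0 := by
    rintro rfl
    rw [mul_zero, mul_zero, sub_zero] at hd
    exact mul_ne_zero hε0 h2pi hd.symm
  have hmem : ∀ t : ℝ, (t : ℂ) * w ∈ S ↔ a ≤ t ∧ t ≤ b := by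
    intro t
    rw [hS]
    constructor
    · rintro ⟨s, hs, hst⟩
      have : s = t := by exact_mod_cast mul_right_cancel₀ hw0 hst
      exact this ▸ hs
    · intro ht
      exact ⟨t, ht, rfl⟩
  -- symmetry forces `a = -b`
  have ha : (a : ℂ) * w ∈ S := (hmem a).2 ⟨le_rfl, hab⟩
  have hb : (b : ℂ) * w ∈ S := (hmem b).2 ⟨hab, le_rfl⟩
  have ha' := (hmem (-a)).1 (by have := hneg _ ha; push_cast; rwa [neg_mul])
  have hb' := (hmem (-b)).1 (by have := hneg _ hb; push_cast; rwa [neg_mul])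
  have hab' : a = -b := by linarith [ha'.2, hb'.1]
  subst hab'
  -- and the endpoint condition forces `b·w = ε·πi` with `0 < b`
  have hbw : (b : ℂ) * w = ε * π * I := by
    have h2 : (2 : ℂ) * ((b : ℂ) * w) = 2 * (ε * π * I) := by
      rw [← sub_eq_zero]; rw [← sub_eq_zero] at hd
      rw [← hd]; push_cast; ring
    exact mul_left_cancel₀ two_ne_zero h2
  have hb0 : b ≠ 0 := by
    rintro rfl
    simp only [ofReal_zero, zero_mul] at hbw
    have : (ε : ℂ) * π * I ≠ 0 := mul_ne_zero (mul_ne_zero hε0 (by exact_mod_cast Real.pi_pos.ne')) I_ne_zero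
    exact this hbw.symm
  have hbpos : 0 < b := lt_of_le_of_ne (by linarith) (Ne.symm hb0)
  rw [hS]
  exact image_Icc_eq_preLogShell_of_mul_eq hbpos hε hbw

/-- `ℐ*` itself is such a segment: `w = i`, `[a, b] = [-π, π]`, preserved by `-1`, endpoints differing by
`2πi`. [cite: MochizukiAbsTopIII2015, Def 5.4 (v) p. 128] -/
theorem preLogShell_isSegment :
    preLogShell = (fun t : ℝ => (t : ℂ) * I) '' Icc (-π) π ∧ (∀ z ∈ preLogShell, -z ∈ preLogShell) ∧
      (π : ℂ) * I - ((-π : ℝ) : ℂ) * I = 2 * π * I :=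
  ⟨rfl, fun _ hz => neg_mem_preLogShell hz, preLogShell_endpoints_sub⟩

/-! ## `ℐ := 𝒪^×_{k~} · ℐ*` -/

/-- the unit circle times `ℐ*` is the closed disc of radius `π`. [cite: MochizukiAbsTopIII2015, Def 5.4 (v) p. 127] -/
theorem sphere_mul_preLogShell : sphere (0 : ℂ) 1 * preLogShell = closedBall (0 : ℂ) π := by
  ext z
  simp only [Set.mem_mul, mem_sphere, dist_zero_right, preLogShell, coreSegment, mem_image, mem_Icc,
    mem_closedBall]
  constructor
  · rintro ⟨u, hu, _, ⟨t, ht, rfl⟩, rfl⟩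
    rw [norm_mul, hu, one_mul, norm_mul, norm_I, mul_one, norm_real, Real.norm_eq_abs]
    exact abs_le.2 ht
  · intro hz
    by_cases h0 : z = 0
    · exact ⟨1, by simp, 0, ⟨0, ⟨by linarith [Real.pi_pos], Real.pi_pos.le⟩, by simp⟩, by simp [h0]⟩
    have hn : (‖z‖ : ℂ) ≠ 0 := by exact_mod_cast norm_ne_zero_iff.2 h0
    refine ⟨z * (-I) / ‖z‖, ?_, ‖z‖ * I, ⟨‖z‖, ⟨by linarith [norm_nonneg z, Real.pi_pos], hz⟩, rfl⟩, ?_⟩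
    · rw [norm_div, norm_mul, norm_neg, norm_I, mul_one, norm_real, Real.norm_eq_abs, abs_norm,
        div_self (norm_ne_zero_iff.2 h0)]
    · have : z * (-I) / (‖z‖ : ℂ) * ((‖z‖ : ℂ) * I) = z * (-I * I) * ((‖z‖ : ℂ) / ‖z‖) := by ring
      rw [this, neg_mul, I_mul_I, neg_neg, mul_one, div_self hn, mul_one]

/-- **Def 5.4 (v)**: `ℐ := 𝒪^×_{k~} · ℐ*` — the typed log-shell IS the product of the unit group `𝒪^×_{k~}`
and the segment `ℐ*`. [cite: MochizukiAbsTopIII2015, Def 5.4 (v) p. 127] -/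
theorem units_mul_preLogShell : units * preLogShell = logShell := by
  rw [units_eq_sphere, logShell_eq_closedBall, sphere_mul_preLogShell]

/-- **Def 5.4 (v), the display** `𝒪_{k~} = π⁻¹ · ℐ ⊆ ℐ := 𝒪^×_{k~} · ℐ* ⊆ k~` ("it follows from well-known
properties of the [complex] logarithm"), with `𝒪_{k~}` the closed unit disc.
[cite: MochizukiAbsTopIII2015, Def 5.4 (v) p. 127] -/
theorem def54v_display :
    closedBall (0 : ℂ) 1 = (π⁻¹ : ℂ) • (units * preLogShell) ∧
      (π⁻¹ : ℂ) • (units * preLogShell) ⊆ units * preLogShell ∧ units * preLogShell ⊆ univ := by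
  rw [units_mul_preLogShell, ← closedBall_one_eq_smul_logShell]
  exact ⟨rfl, closedBall_one_subset_logShell, subset_univ _⟩

/-! ## `ℐ*` covers the pre-log-shell `𝒪^×_k ⊆ k^×` bijectively except for its endpoints -/

/-- the image of `ℐ*` under `k~ ↠ k^×` (`= exp`) is the pre-log-shell `𝒪^×_k` = the unit circle.
[cite: MochizukiAbsTopIII2015, Def 5.4 (v) p. 128] -/
theorem exp_image_preLogShell : exp '' preLogShell = sphere (0 : ℂ) 1 := by
  ext u
  simp only [mem_image, preLogShell, coreSegment, mem_Icc, mem_sphere, dist_zero_right]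
  constructor
  · rintro ⟨_, ⟨t, _, rfl⟩, rfl⟩
    exact norm_exp_ofReal_mul_I t
  · intro hu
    refine ⟨arg u * I, ⟨arg u, ⟨(neg_pi_lt_arg u).le, arg_le_pi u⟩, rfl⟩, ?_⟩
    have h := norm_mul_exp_arg_mul_I u
    rwa [hu, ofReal_one, one_mul] at h

/-- the two endpoints of `ℐ*` have the same image `-1` in `k^×`. [cite: MochizukiAbsTopIII2015, Def 5.4 (v) p. 128] -/
theorem exp_endpoints_eq : exp ((π : ℂ) * I) = -1 ∧ exp (((-π : ℝ) : ℂ) * I) = -1 := by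
  refine ⟨exp_pi_mul_I, ?_⟩
  rw [ofReal_neg, neg_mul, exp_neg, exp_pi_mul_I]; norm_num

/-- **Def 5.4 (v)**: "`ℐ*` maps bijectively, except for the endpoints of the line segment, to the
pre-log-shell": `exp` restricted to `ℐ*` minus the endpoint `-πi` is a bijection onto the unit circle.
[cite: MochizukiAbsTopIII2015, Def 5.4 (v) p. 128] -/
theorem bijOn_exp_preLogShell_diff_endpoint :
    BijOn exp (preLogShell \ {(((-π : ℝ) : ℂ)) * I}) (sphere (0 : ℂ) 1) := by
  refine ⟨fun z hz => ?_, fun x hx y hy hxy => ?_, fun u hu => ?_⟩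
  · rw [← exp_image_preLogShell]
    exact mem_image_of_mem _ hz.1
  · obtain ⟨⟨s, ⟨hs1, hs2⟩, rfl⟩, hsx⟩ := hx
    obtain ⟨⟨t, ⟨ht1, ht2⟩, rfl⟩, hty⟩ := hy
    have hs1' : -π < s := lt_of_le_of_ne hs1 (by rintro rfl; exact hsx rfl)
    have ht1' : -π < t := lt_of_le_of_ne ht1 (by rintro rfl; exact hty rfl)
    obtain ⟨n, hn⟩ := exp_eq_exp_iff_exists_int.1 hxy
    have hst : s = t + n * (2 * π) := by
      have := congrArg im hn
      simpa using this
    have hn0 : n = 0 := by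
      have h1 : (n : ℝ) * (2 * π) < 2 * π := by nlinarith
      have h2 : -(2 * π) < (n : ℝ) * (2 * π) := by nlinarith
      have h3 : (n : ℝ) < 1 := by nlinarith [Real.pi_pos]
      have h4 : (-1 : ℝ) < n := by nlinarith [Real.pi_pos]
      have h3' : n < 1 := by exact_mod_cast h3
      have h4' : -1 < n := by exact_mod_cast h4
      omega
    rw [hst, hn0]; simp
  · have hu' : ‖u‖ = 1 := by simpa using hu
    refine ⟨arg u * I, ⟨⟨arg u, ⟨(neg_pi_lt_arg u).le, arg_le_pi u⟩, rfl⟩, fun h => ?_⟩, ?_⟩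
    · have h' : arg u = -π := by
        have := mul_right_cancel₀ I_ne_zero (h : (arg u : ℂ) * I = ((-π : ℝ) : ℂ) * I)
        exact_mod_cast this
      exact (neg_pi_lt_arg u).ne' h'
    · have h := norm_mul_exp_arg_mul_I u
      rwa [hu', ofReal_one, one_mul] at h

/-! ## `ℐ` from `ℐ*` via the finite-order automorphisms of `k~` -/

/-- **Def 5.4 (v)**: "`ℐ` may be constructed as the closure of the union of the images of `ℐ*` via the finite
order automorphisms of the Aut-holomorphic group `k~`" — in the model, the closure of `⋃_ζ ζ·ℐ*` over the roots
of unity `ζ` (the finite-order holomorphic additive automorphisms `z ↦ ζ·z` of `k~ ≅ ℂ`) is the log-shell `ℐ`.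
[cite: MochizukiAbsTopIII2015, Def 5.4 (v) p. 128] -/
theorem closure_iUnion_rootOfUnity_smul_preLogShell :
    closure (⋃ (n : ℕ) (_ : 0 < n) (ζ : ℂ) (_ : ζ ^ n = 1), ζ • preLogShell) = logShell := by
  rw [logShell_eq_closedBall]
  apply Subset.antisymm
  · -- each `ζ·ℐ*` lies in the closed disc of radius `π`, which is closed
    refine closure_minimal ?_ isClosed_closedBall
    intro z hz
    simp only [mem_iUnion, Set.mem_smul_set, smul_eq_mul] at hz
    obtain ⟨n, hn, ζ, hζ, y, ⟨t, ht, rfl⟩, rfl⟩ := hz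
    rw [mem_closedBall, dist_zero_right, norm_mul, norm_eq_one_of_pow_eq_one hζ hn.ne', one_mul, norm_mul,
      norm_I, mul_one, norm_real, Real.norm_eq_abs]
    exact abs_le.2 ht
  · -- density: `z = exp(θ₀ i)·(‖z‖ i)`; approximate `θ₀` by `2πq`, `q ∈ ℚ`, so that `exp(2πq i)` is a root of unity
    intro z hz
    rw [mem_closedBall, dist_zero_right] at hz
    rw [Metric.mem_closure_iff]
    intro δ hδ
    set r : ℝ := ‖z‖ with hr
    have hrI : (r : ℂ) * I ∈ preLogShell := ⟨r, ⟨by linarith [norm_nonneg z, Real.pi_pos], hz⟩, rfl⟩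
    -- the angle
    obtain ⟨θ₀, hθ₀⟩ : ∃ θ₀ : ℝ, exp (θ₀ * I) * (r * I) = z := by
      by_cases h0 : z = 0
      · exact ⟨0, by simp [hr, h0]⟩
      · have hr0 : (r : ℂ) ≠ 0 := by exact_mod_cast norm_ne_zero_iff.2 h0
        set u : ℂ := z / (r * I) with hu
        have hu1 : ‖u‖ = 1 := by
          rw [hu, norm_div, norm_mul, norm_I, mul_one, norm_real, Real.norm_eq_abs, hr, abs_norm,
            div_self (norm_ne_zero_iff.2 h0)]
        refine ⟨arg u, ?_⟩
        have h := norm_mul_exp_arg_mul_I u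
        rw [hu1, ofReal_one, one_mul] at h
        rw [h, hu, div_mul_cancel₀ _ (mul_ne_zero hr0 I_ne_zero)]
    -- continuity of `θ ↦ exp(θ i)·(r i)` at `θ₀`
    have hcont : Continuous fun θ : ℝ => exp (θ * I) * (r * I) := by fun_prop
    obtain ⟨η, hη, hηδ⟩ := Metric.continuous_iff.1 hcont θ₀ δ hδ
    -- a rational `q` with `|2πq - θ₀| < η`
    have h2pi : (0 : ℝ) < 2 * π := by positivity
    obtain ⟨q, hq1, hq2⟩ := exists_rat_btwn (show (θ₀ - η) / (2 * π) < (θ₀ + η) / (2 * π) from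
      div_lt_div_of_pos_right (by linarith) h2pi)
    have hqθ : dist (2 * π * (q : ℝ)) θ₀ < η := by
      rw [Real.dist_eq, abs_lt]
      rw [div_lt_iff₀ h2pi] at hq1
      rw [lt_div_iff₀ h2pi] at hq2
      constructor <;> linarith
    refine ⟨exp ((2 * π * (q : ℝ) : ℝ) * I) * (r * I), ?_, ?_⟩
    · -- it lies in `ζ·ℐ*` for the root of unity `ζ = exp(2πq i)`, `ζ^(q.den) = 1`
      simp only [mem_iUnion, Set.mem_smul_set, smul_eq_mul]
      refine ⟨q.den, q.den_pos, exp ((2 * π * (q : ℝ) : ℝ) * I), ?_, (r : ℂ) * I, hrI, rfl⟩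
      rw [← Complex.exp_nat_mul]
      have hqd : (q : ℂ) * (q.den : ℂ) = (q.num : ℂ) := by exact_mod_cast Rat.mul_den_eq_num q
      have : (q.den : ℂ) * (((2 * π * (q : ℝ) : ℝ) : ℂ) * I) = (q.num : ℂ) * (2 * π * I) := by
        push_cast
        rw [← hqd]; ring
      rw [this]
      exact exp_int_mul_two_pi_mul_I q.num
    · rw [← hθ₀, dist_comm]
      exact hηδ _ hqθ

end ComplexLogShell

end Literature.AnabelianGeometry.AbsoluteAnabelian

end
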